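import Summits.FinalStateConjecture.FinalStateConjecture.Theses.BartnikGapSettling
import HarnessLib

/-!
# Crux `BartnikGapSettling.SettledCapture` (stmt-FinalStateConjecture-17328) CONTAINS the sibling crux
# `QuietWindowCapture.Capture` (stmt-FinalStateConjecture-10115)

Negative-lane bookkeeping from the line lead of crux `SettledCapture` (line `birth`, 2026-08-17;
`prover-line-stmt-FinalStateConjecture-17328-0`). No Theses decl is asserted positively.

The two cruxes have BYTE-IDENTICAL hypotheses (admissible datum, maximal vacuum development, complete
`𝓘⁺`, the 40-binder NEAR-SUBEXTREMAL-KERR-LEAVES block) and `SettledCapture`'s conclusion is `Capture`'s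
(sub-extremal holes, `O = exteriorOf 𝒟 d.charted`, `HasExhaustiveCharts d`) with the two T2 clauses
`RaysStayInClosure 𝒟 O` and `IsFutureOriented d` added (grounder g70-5, token diff 2026-08-16). Hence
`SettledCapture → Capture` (`capture_of_settledCapture`) and, contrapositively, every refutation of
`Capture` refutes `SettledCapture` (`not_settledCapture_of_not_capture`): the four dead-line dossiers of
`Capture` (`Cruxes/Capture/Lines/*-dead.md`: under THE DODGE of the typed leaf block —
`Literature/Geometry/Lorentzian/NearKerrLeafMinkowskiBoostedDodge.lean`,
`Theorems/BartnikGapSettlingCaptureStubMinkowskiDodgeLeaves.lean`, `Negative/TypedNormalForm.lean`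
`leafHyp_minkowski` — the hypothesis is idle on paper, so the typed crux is the non-generic settling
clause, paper-false modulo extremal-Kerr formation in vacuum) transfer to this crux verbatim, and so
does the recorded repair (re-type the leaf block over `CauchyDevelopment.IsSoundNearKerrLeaf`).
The same projection shows that stub 1 of line `birth` (`ExteriorCapture` = the conclusion without the
ray clause) already contains `Capture` (`capture_of_exteriorCapture`, stated with the stub's conclusion
inlined).

References: Dafermos–Luk, arXiv:1710.01722, Conjecture 1 (statement shape); Kehle–Unger,
arXiv:2402.10190, Conjecture 5 (extremal critical collapse).
-/

set_option linter.dupNamespace false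

noncomputable section

open Set
open scoped Manifold ContDiff ENNReal
open Literature.Geometry.Lorentzian

namespace Summit.FinalStateConjecture.FinalStateConjecture.Theorems.SettledCapture.Negative

open Summit.FinalStateConjecture.FinalStateConjecture.Theses

/-- **Record of the sibling crux `QuietWindowCapture.Capture`** (item stmt-FinalStateConjecture-10115 of route
QuietWindowCapture): its ledger signature VERBATIM (= the body of
`Summit.FinalStateConjecture.FinalStateConjecture.Theses.QuietWindowCapture.Capture` in the current route file).
Declared in THIS file's namespace instead of importing the route file `Theses/QuietWindowCapture.lean`, which
has not built since the T2 summit re-type of 2026-08-16 (its `closes` glue fails at :349; the item itself is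
unchanged), so that this module builds again; the two theorems below keep their accepted text and denote exactly
what they were accepted for (2026-08-17, against this same signature text). If the planners restate item
10115, this record and the two theorems speak about the signature recorded here (buildfix ops lane 2026-08-20,
deprecate-and-add: no accepted statement edited; a record of a ledger ITEM, not a published fact). -/
def QuietWindowCapture.Capture : Prop :=
  open Literature.Geometry.Lorentzian in ∀ (X : Type) [TopologicalSpace X] [ChartedSpace E3 X] [IsManifold (𝓡 3) ((⊤ : ℕ∞) : WithTop ℕ∞) X] [T2Space X] [SecondCountableTopology X] [ConnectedSpace X], ∀ D ∈ admissibleVacuumData X, ∀ 𝒟 : VacuumCauchyDevelopment D, 𝒟.IsMaximal → Summit.FinalStateConjecture.HasCompleteNullInfinity 𝒟.toCauchyDevelopment → (∃ (N₀ : ℕ) (m₀ χ : ℝ) (k₁ : ℕ) (ε₁ : ENNReal), 0 < m₀ ∧ χ < 1 ∧ 0 < ε₁ ∧ ∀ (k : ℕ) (ε : ENNReal), 0 < ε → ∀ K : Set 𝒟.carrier, IsCompact K → ∃ (N : ℕ) (M a : Fin N → ℝ) (S : Set 𝒟.carrier), N ≤ N₀ ∧ (∀ i, m₀ ≤ M i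 ∧ M i ≤ m₀⁻¹) ∧ Disjoint S (𝒟.metric.causalPast 𝒟.timeOrientation K) ∧ (∃ (R ρ : Fin N → ℝ) (mo : Fin N → lorentzGroup × E4) (r : Fin N → E4 → ℝ) (B : Fin N → ModelBackground) (U₀ : TopologicalSpace.Opens E4) (B₀ : ModelBackground) (Ψ : ∀ i, (B i).domain → 𝒟.carrier) (Ψ₀ : B₀.domain → 𝒟.carrier) (L W : ∀ i, Set (B i).domain) (L₀ W₀ : Set B₀.domain), (∀ i, r i = fun x => Kerr.radius (a i) (poincareInv (mo i).1 (mo i).2 x)) ∧ (∀ i, B i = (⟨⟨poincareInv (mo i).1 (mo i).2 ⁻¹' (Kerr.region (a i) (M i) : Set E4), (Kerr.region (a i) (M i)).isOpen.preimage (continuous_poincareInv (mo i).1 (mo i).2)⟩, boostedKerrBilin (mo i).1 (mo i).2 (M i) (a i), fun x => poincareInv (mo i).1 (mo i).2 x 0, r i⟩ : ModelBackground)) ∧ B₀ = (⟨U₀, fun _ => Minkowski.bilin, fun x => x 0 - Real.sqrt (1 + E4.spatialNorm x ^ 2), E4.spatialNorm⟩ : ModelBackground) ∧ (∀ i, L i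 = {x | -1 < (B i).time x.1 ∧ (B i).time x.1 < 1 ∧ (B i).radius x.1 < R i + 1} ∧ W i = {x | 0 < (B i).time x.1 ∧ (B i).time x.1 < 1 ∧ (B i).radius x.1 ≤ R i}) ∧ L₀ = {x | -1 < B₀.time x.1 ∧ B₀.time x.1 < 1} ∧ W₀ = {x | 0 < B₀.time x.1 ∧ B₀.time x.1 < 1} ∧ (∀ i, 0 < M i ∧ |a i| ≤ M i ∧ 0 < ρ i ∧ ρ i < R i) ∧ {x : E4 | -1 < x 0 - Real.sqrt (1 + E4.spatialNorm x ^ 2) ∧ ∀ i, ρ i < r i x} ⊆ (U₀ : Set E4) ∧ (∀ i, ContMDiffOn 𝓘(ℝ, E4) (𝓡 4) ((⊤ : ℕ∞) : WithTop ℕ∞) (Ψ i) (L i) ∧ Topology.IsOpenEmbedding ((L i).restrict (Ψ i)) ∧ Ψ i '' L i ⊆ 𝒟.metric.causalFuture 𝒟.timeOrientation (Set.range 𝒟.embed)) ∧ ContMDiffOn 𝓘(ℝ, E4) (𝓡 4) ((⊤ : ℕ∞) : WithTop ℕ∞) Ψ₀ L₀ ∧ Topology.IsOpenEmbedding (L₀.restrict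 Ψ₀) ∧ Ψ₀ '' L₀ ⊆ 𝒟.metric.causalFuture 𝒟.timeOrientation (Set.range 𝒟.embed) ∧ (∀ i, 𝒟.toSpacetime.truncDeviationCk (B i) (Ψ i) k (R i) 0 ≤ ε) ∧ 𝒟.toSpacetime.deviationCk B₀ Ψ₀ k 0 ≤ ε ∧ Pairwise (Function.onFun Disjoint fun i => Ψ i '' {x | x ∈ L i ∧ (B i).radius x.1 ≤ R i}) ∧ (∀ i, Ψ i '' {x | (B i).time x.1 = 0 ∧ ρ i < (B i).radius x.1 ∧ (B i).radius x.1 ≤ R i} ⊆ Ψ₀ '' L₀) ∧ (∀ i, Ψ₀ '' {x | B₀.time x.1 = 0 ∧ ρ i < r i x.1 ∧ r i x.1 < R i} ⊆ Ψ i '' L i) ∧ S = Ψ₀ '' B₀.timeSlab 0 ∪ ⋃ i, Ψ i '' (B i).truncTimeSlab (R i) 0 ∧ Ψ₀ '' W₀ ∪ ⋃ i, Ψ i '' W i ⊆ 𝒟.metric.chronologicalFuture 𝒟.timeOrientation S ∧ Summit.FinalStateConjecture.exteriorOf 𝒟.toCauchyDevelopment (Ψ₀ '' W₀ ∪ ⋃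 i, Ψ i '' W i) \ (Ψ₀ '' W₀ ∪ ⋃ i, Ψ i '' W i) ⊆ 𝒟.metric.causalPast 𝒟.timeOrientation S) ∧ (k₁ ≤ k → ε ≤ ε₁ → ∀ i, |a i| ≤ χ * M i)) → (∃ (O : Set 𝒟.carrier) (d : FinalStateDecomposition 𝒟.toSpacetime O 2), (∀ i, Kerr.IsSubextremal (d.mass i) (d.spin i)) ∧ O = Summit.FinalStateConjecture.exteriorOf 𝒟.toCauchyDevelopment d.charted ∧ Summit.FinalStateConjecture.HasExhaustiveCharts d)

/-- **`SettledCapture` implies `Capture`**: same hypotheses; drop the two T2 clauses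
(`RaysStayInClosure`, `IsFutureOriented`) from the conclusion. [cite: DafermosLuk2017, Conjecture 1] -/
theorem capture_of_settledCapture (h : BartnikGapSettling.SettledCapture) : QuietWindowCapture.Capture := by
  intro X _ _ _ _ _ _ D hD 𝒟 hmax hscri hleaves
  obtain ⟨O, d, hsub, hO, -, hexh, -⟩ := h X D hD 𝒟 hmax hscri hleaves
  exact ⟨O, d, hsub, hO, hexh⟩

/-- Contrapositive: **every refutation of `Capture` refutes `SettledCapture`** (the sibling's dead-line
record and its eventual `¬Capture` transfer). [cite: DafermosLuk2017, Conjecture 1] -/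
theorem not_settledCapture_of_not_capture (h : ¬ QuietWindowCapture.Capture) :
    ¬ BartnikGapSettling.SettledCapture :=
  fun hs => h (capture_of_settledCapture hs)

end Summit.FinalStateConjecture.FinalStateConjecture.Theorems.SettledCapture.Negative

end
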